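import Summits.NavierStokesRegularity.NavierStokesRegularity.Theorems.ExtremiserTransienceNearExtremalTransienceExtremiserLiouvilleConstantSpeedSlidePalinstrophyDensity
import Literature.Analysis.FluidPDE.TaoEnstrophyLocalisationProofs
import HarnessLib

/-!
# Crux `ExtremiserTransience.NearExtremalTransience` (stmt-NavierStokesRegularity-21883), line `extremiser_liouville`,
# stub K1b — THE TWO SECOND-ORDER DENSITIES OF `Ĉ₁` CANCEL TO A DIFFERENCE OF SQUARES (record §15/§16, R6a-int)

`--supports stmt-NavierStokesRegularity-21883` (helper).  Author: prover seat `ns-el-k1b` (g9).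

In the layer inequality (INEQ)₃ (`…ConstantSpeedSlideInequalityLayer.slideInequality_layer`) the palinstrophy variation `Ĉ₁`
carries, besides `−½∫g′|Dω|²_F` and `−∫g′‖∂₂ω‖²` (converted to `D²V`-forms by `…ConstantSpeedSlidePalinstrophyFrobenius`),
two further SECOND-ORDER densities with the weight `g′`:
`−Σᵢ⟪∂ᵢω, ∂₂∂ᵢB⟫` (`B = (−V₁, V₀, 0) = e₂ × V`, from `sum_inner_fderiv_curlRemainder_axis`) and
`+Σᵢ((∂ᵢω)₀(∂ᵢ∂₁V)₂ − (∂ᵢω)₁(∂ᵢ∂₀V)₂)` (from `sum_inner_slideCoeffDeriv`).  Each alone contains the indefinite cross term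
`Σᵢ Σ_{a<2} (∂ᵢ∂₂V_a)(∂ᵢ∂_aV₂)`; in the difference it CANCELS, pointwise and for every direction `w`:
```
  (∂_wω)₀(∂_w∂₁V)₂ − (∂_wω)₁(∂_w∂₀V)₂ − ⟪∂_wω, ∂₂∂_wB⟫ = (∂_w∂₀V)₂² + (∂_w∂₁V)₂² − (∂₂∂_wV)₀² − (∂₂∂_wV)₁²
```
i.e. summed over a basis `|∇∇_hV₂|² − |∇∂₂V_h|²` — a pure `D²V`-quadratic form, with no integration by parts at all
(only `curl ∂_wV = ∂_wω` and the symmetry of `D²V`).  So after this file every `g′`-weighted second-order density of `Ĉ₁` is an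
explicit quadratic form in `D²V` (the input of the absorption ledger R6b, record §15).
* `crossCLM_apply'`, `fderiv_fderiv_crossField_apply` : `∂₂∂_wB = (−(∂₂∂_wV)₁, (∂₂∂_wV)₀, 0)`;
* `fderiv_crossField_sub_const` : the cross field of `V − c` has the same derivative (the (INEQ)₃ form uses `v − c`);
* `slideCoeffDeriv_sub_inner_crossHessian_eq` : the displayed identity; `sum_slideCoeffDeriv_sub_inner_crossHessian_eq` : summed.

WHAT THIS IS NOT: K1b is NOT proved; nothing here proves NS regularity. [folklore]
-/

noncomputable section

open Set Filter Topology MeasureTheory Metric Function InnerProductSpace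
open scoped ENNReal NNReal Topology InnerProductSpace RealInnerProductSpace ContDiff
open Literature.Analysis.FluidPDE Literature.Analysis

namespace Summit.NavierStokesRegularity.NavierStokesRegularity.Theorems

-- the problem directory repeats the summit name (`NavierStokesRegularity/NavierStokesRegularity`)
set_option linter.dupNamespace false

namespace ExtremiserLiouville

open DepletionLadder.KStar

variable {V : EuclideanSpace ℝ (Fin 3) → EuclideanSpace ℝ (Fin 3)}

/-! ## 1. Derivatives of the cross field `B = (−V₁, V₀, 0)` -/

/-- The cross map `L = −dx₁ ⊗ e₀ + dx₀ ⊗ e₁` acts by `L z = (−z₁, z₀, 0)`. [folklore] -/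
theorem crossCLM_apply' (z : EuclideanSpace ℝ (Fin 3)) :
    ((-(EuclideanSpace.proj (1 : Fin 3) : EuclideanSpace ℝ (Fin 3) →L[ℝ] ℝ)).smulRight (EuclideanSpace.single (0 : Fin 3) (1 : ℝ)) + (EuclideanSpace.proj (0 : Fin 3) : EuclideanSpace ℝ (Fin 3) →L[ℝ] ℝ).smulRight (EuclideanSpace.single (1 : Fin 3) (1 : ℝ))) z = (-z 1) • EuclideanSpace.single (0 : Fin 3) (1 : ℝ) + (z 0) • EuclideanSpace.single (1 : Fin 3) (1 : ℝ) := by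
  simp [ContinuousLinearMap.smulRight_apply]

/-- **`D(∂_wB)(x)u = (−(D(∂_wV)(x)u)₁, (D(∂_wV)(x)u)₀, 0)`** for the cross field `B = (−V₁, V₀, 0)` of a `C²` field `V`
(`B = L∘V` with `L` linear, twice the chain rule). [folklore] -/
theorem fderiv_fderiv_crossField_apply (hV : ContDiff ℝ 2 V) (x w u : EuclideanSpace ℝ (Fin 3)) :
    fderiv ℝ (fun y => fderiv ℝ (fun z : EuclideanSpace ℝ (Fin 3) => (-V z 1) • EuclideanSpace.single (0 : Fin 3) (1 : ℝ) + (V z 0) • EuclideanSpace.single (1 : Fin 3) (1 : ℝ)) y w) x u =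
      (-(fderiv ℝ (fun y => fderiv ℝ V y w) x u) 1) • EuclideanSpace.single (0 : Fin 3) (1 : ℝ) + (fderiv ℝ (fun y => fderiv ℝ V y w) x u 0) • EuclideanSpace.single (1 : Fin 3) (1 : ℝ) := by
  have hVd : Differentiable ℝ V := hV.differentiable (by norm_num)
  have hu : ContDiff ℝ 1 fun y => fderiv ℝ V y w := (hV.fderiv_right (m := 1) (by norm_num)).clm_apply contDiff_const
  have hud : Differentiable ℝ fun y => fderiv ℝ V y w := hu.differentiable one_ne_zero
  have h1 : (fun y => fderiv ℝ (fun z : EuclideanSpace ℝ (Fin 3) => (-V z 1) • EuclideanSpace.single (0 : Fin 3) (1 : ℝ) + (V z 0) • EuclideanSpace.single (1 : Fin 3) (1 : ℝ)) y w) =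
      ⇑((-(EuclideanSpace.proj (1 : Fin 3) : EuclideanSpace ℝ (Fin 3) →L[ℝ] ℝ)).smulRight (EuclideanSpace.single (0 : Fin 3) (1 : ℝ)) + (EuclideanSpace.proj (0 : Fin 3) : EuclideanSpace ℝ (Fin 3) →L[ℝ] ℝ).smulRight (EuclideanSpace.single (1 : Fin 3) (1 : ℝ))) ∘ fun y => fderiv ℝ V y w := by
    funext y
    rw [crossField_eq_comp V, ((((-(EuclideanSpace.proj (1 : Fin 3) : EuclideanSpace ℝ (Fin 3) →L[ℝ] ℝ)).smulRight (EuclideanSpace.single (0 : Fin 3) (1 : ℝ)) + (EuclideanSpace.proj (0 : Fin 3) : EuclideanSpace ℝ (Fin 3) →L[ℝ] ℝ).smulRight (EuclideanSpace.single (1 : Fin 3) (1 : ℝ)))).hasFDerivAt.comp y (hVd y).hasFDerivAt).fderiv]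
    rfl
  rw [h1, ((((-(EuclideanSpace.proj (1 : Fin 3) : EuclideanSpace ℝ (Fin 3) →L[ℝ] ℝ)).smulRight (EuclideanSpace.single (0 : Fin 3) (1 : ℝ)) + (EuclideanSpace.proj (0 : Fin 3) : EuclideanSpace ℝ (Fin 3) →L[ℝ] ℝ).smulRight (EuclideanSpace.single (1 : Fin 3) (1 : ℝ)))).hasFDerivAt.comp x (hud x).hasFDerivAt).fderiv, ContinuousLinearMap.comp_apply, crossCLM_apply']

/-- The cross field of `V − c` differs from that of `V` by a constant, so it has the same derivative. [folklore] -/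
theorem fderiv_crossField_sub_const (c : EuclideanSpace ℝ (Fin 3)) :
    fderiv ℝ (fun z : EuclideanSpace ℝ (Fin 3) => (-(V z - c) 1) • EuclideanSpace.single (0 : Fin 3) (1 : ℝ) + ((V z - c) 0) • EuclideanSpace.single (1 : Fin 3) (1 : ℝ)) = fderiv ℝ (fun z : EuclideanSpace ℝ (Fin 3) => (-V z 1) • EuclideanSpace.single (0 : Fin 3) (1 : ℝ) + (V z 0) • EuclideanSpace.single (1 : Fin 3) (1 : ℝ)) := by
  have h : (fun z : EuclideanSpace ℝ (Fin 3) => (-(V z - c) 1) • EuclideanSpace.single (0 : Fin 3) (1 : ℝ) + ((V z - c) 0) • EuclideanSpace.single (1 : Fin 3) (1 : ℝ)) = fun z => ((-V z 1) • EuclideanSpace.single (0 : Fin 3) (1 : ℝ) + (V z 0) • EuclideanSpace.single (1 : Fin 3) (1 : ℝ)) + ((c 1) • EuclideanSpace.single (0 : Fin 3) (1 : ℝ) + (-c 0) • EuclideanSpace.single (1 : Fin 3) (1 : ℝ)) := by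
    funext z
    simp only [PiLp.sub_apply, neg_sub]
    module
  rw [h]
  funext x
  exact fderiv_add_const _

/-! ## 2. The cancellation -/

/-- **The two second-order densities of `Ĉ₁` cancel to a difference of squares**: for `V ∈ C^∞` (in fact `C²`), `ω = curl V`,
`B = (−V₁, V₀, 0)`, every `x` and every direction `w`,
`(∂_wω)₀(∂_w∂₁V)₂ − (∂_wω)₁(∂_w∂₀V)₂ − ⟪∂_wω, ∂₂∂_wB⟫ = (∂_w∂₀V)₂² + (∂_w∂₁V)₂² − (∂₂∂_wV)₀² − (∂₂∂_wV)₁²`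
(`∂_a∂_bV := D(D V(·) b)(x) a`; `curl ∂_wV = ∂_wω`, symmetry of `D²V`, and algebra). [folklore] -/
theorem slideCoeffDeriv_sub_inner_crossHessian_eq (hV : ContDiff ℝ 2 V) (x w : EuclideanSpace ℝ (Fin 3)) :
    (fderiv ℝ (curl V) x w 0 * fderiv ℝ (fun y => fderiv ℝ V y (EuclideanSpace.single (1 : Fin 3) (1 : ℝ))) x w 2 - fderiv ℝ (curl V) x w 1 * fderiv ℝ (fun y => fderiv ℝ V y (EuclideanSpace.single (0 : Fin 3) (1 : ℝ))) x w 2) -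
        ⟪fderiv ℝ (curl V) x w, fderiv ℝ (fun y => fderiv ℝ (fun z : EuclideanSpace ℝ (Fin 3) => (-V z 1) • EuclideanSpace.single (0 : Fin 3) (1 : ℝ) + (V z 0) • EuclideanSpace.single (1 : Fin 3) (1 : ℝ)) y w) x (EuclideanSpace.single (2 : Fin 3) (1 : ℝ))⟫ =
      fderiv ℝ (fun y => fderiv ℝ V y (EuclideanSpace.single (0 : Fin 3) (1 : ℝ))) x w 2 ^ 2 + fderiv ℝ (fun y => fderiv ℝ V y (EuclideanSpace.single (1 : Fin 3) (1 : ℝ))) x w 2 ^ 2 - fderiv ℝ (fun y => fderiv ℝ V y w) x (EuclideanSpace.single (2 : Fin 3) (1 : ℝ)) 0 ^ 2 - fderiv ℝ (fun y => fderiv ℝ V y w) x (EuclideanSpace.single (2 : Fin 3) (1 : ℝ)) 1 ^ 2 := by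
  have hu2 : ∀ a : EuclideanSpace ℝ (Fin 3), fderiv ℝ (curl V) x a = curl (fun y => fderiv ℝ V y a) x := fun a => (curl_fderiv_apply hV x a).symm
  have hsym := hV.contDiffAt (x := x) |>.isSymmSndFDerivAt (n := 2) (by simp)
  have sym : ∀ a b : EuclideanSpace ℝ (Fin 3), fderiv ℝ (fun y => fderiv ℝ V y a) x b = fderiv ℝ (fun y => fderiv ℝ V y b) x a := fun a b => by
    rw [fderiv_fderiv_apply_eq hV, fderiv_fderiv_apply_eq hV]; exact hsym a b
  have c0 : curl (fun y => fderiv ℝ V y w) x 0 =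
      fderiv ℝ (fun y => fderiv ℝ V y w) x (EuclideanSpace.single (1 : Fin 3) (1 : ℝ)) 2 - fderiv ℝ (fun y => fderiv ℝ V y w) x (EuclideanSpace.single (2 : Fin 3) (1 : ℝ)) 1 := by simp [curl]
  have c1 : curl (fun y => fderiv ℝ V y w) x 1 =
      fderiv ℝ (fun y => fderiv ℝ V y w) x (EuclideanSpace.single (2 : Fin 3) (1 : ℝ)) 0 - fderiv ℝ (fun y => fderiv ℝ V y w) x (EuclideanSpace.single (0 : Fin 3) (1 : ℝ)) 2 := by simp [curl]
  rw [fderiv_fderiv_crossField_apply hV, inner_add_right, inner_smul_right, inner_smul_right, EuclideanSpace.inner_single_right,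
    EuclideanSpace.inner_single_right]
  simp only [conj_trivial, one_mul, hu2, c0, c1]
  rw [sym w (EuclideanSpace.single (1 : Fin 3) (1 : ℝ)), sym w (EuclideanSpace.single (0 : Fin 3) (1 : ℝ))]
  ring

/-- The cancellation summed over the standard basis: `Σᵢ[(∂ᵢω)₀(∂ᵢ∂₁V)₂ − (∂ᵢω)₁(∂ᵢ∂₀V)₂] − Σᵢ⟪∂ᵢω, ∂₂∂ᵢB⟫ =
Σᵢ[(∂ᵢ∂₀V)₂² + (∂ᵢ∂₁V)₂² − (∂₂∂ᵢV)₀² − (∂₂∂ᵢV)₁²]` (`= |∇∇_hV₂|² − |∇∂₂V_h|²`). [folklore] -/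
theorem sum_slideCoeffDeriv_sub_inner_crossHessian_eq (hV : ContDiff ℝ 2 V) (x : EuclideanSpace ℝ (Fin 3)) :
    (∑ i : Fin 3, (fderiv ℝ (curl V) x (EuclideanSpace.basisFun (Fin 3) ℝ i) 0 * fderiv ℝ (fun y => fderiv ℝ V y (EuclideanSpace.single (1 : Fin 3) (1 : ℝ))) x (EuclideanSpace.basisFun (Fin 3) ℝ i) 2 - fderiv ℝ (curl V) x (EuclideanSpace.basisFun (Fin 3) ℝ i) 1 * fderiv ℝ (fun y => fderiv ℝ V y (EuclideanSpace.single (0 : Fin 3) (1 : ℝ))) x (EuclideanSpace.basisFun (Fin 3) ℝ i) 2)) -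
        ∑ i : Fin 3, ⟪fderiv ℝ (curl V) x (EuclideanSpace.basisFun (Fin 3) ℝ i), fderiv ℝ (fun y => fderiv ℝ (fun z : EuclideanSpace ℝ (Fin 3) => (-V z 1) • EuclideanSpace.single (0 : Fin 3) (1 : ℝ) + (V z 0) • EuclideanSpace.single (1 : Fin 3) (1 : ℝ)) y (EuclideanSpace.basisFun (Fin 3) ℝ i)) x (EuclideanSpace.single (2 : Fin 3) (1 : ℝ))⟫ =
      ∑ i : Fin 3, (fderiv ℝ (fun y => fderiv ℝ V y (EuclideanSpace.single (0 : Fin 3) (1 : ℝ))) x (EuclideanSpace.basisFun (Fin 3) ℝ i) 2 ^ 2 + fderiv ℝ (fun y => fderiv ℝ V y (EuclideanSpace.single (1 : Fin 3) (1 : ℝ))) x (EuclideanSpace.basisFun (Fin 3) ℝ i) 2 ^ 2 - fderiv ℝ (fun y => fderiv ℝ V y (EuclideanSpace.basisFun (Fin 3) ℝ i)) x (EuclideanSpace.single (2 : Fin 3) (1 : ℝ)) 0 ^ 2 - fderiv ℝ (fun y => fderiv ℝ V y (EuclideanSpace.basisFun (Fin 3) ℝ i)) x (EuclideanSpace.single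 (2 : Fin 3) (1 : ℝ)) 1 ^ 2) := by
  rw [← Finset.sum_sub_distrib]
  exact Finset.sum_congr rfl fun i _ => slideCoeffDeriv_sub_inner_crossHessian_eq hV x _

end ExtremiserLiouville

end Summit.NavierStokesRegularity.NavierStokesRegularity.Theorems

end
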